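import Summits.AtomisticToContinuum.HydrodynamicLimit.Theorems.StiffCollisionalRelaxationAprioriBoundsFibreDefsR4
import Summits.AtomisticToContinuum.HydrodynamicLimit.Theorems.AprioriBounds.Negative.ExpMomentTangent
import Summits.AtomisticToContinuum.HydrodynamicLimit.Theorems.JParityClosureOddContactSymmetryGibbsInvariance
import Summits.AtomisticToContinuum.HydrodynamicLimit.Theorems.JaynesSqueezeLocalGibbsConcentrationDiluteDensityLDA
import Literature.MathematicalPhysics.KineticTheory.HardSphereUniformGasShift
import HarnessLib

/-!
# The ceiling in the mean at homogeneous data (equilibrium instance of stub `stub_meanCeiling`,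
# line `meso-chebyshev-window`, crux `AprioriBounds`, stmt-AtomisticToContinuum-14827)

Helper file (`--supports stmt-AtomisticToContinuum-14827`) of the line `meso-chebyshev-window` for the crux
`Summit.AtomisticToContinuum.HydrodynamicLimit.Theses.StiffCollisionalRelaxation.AprioriBounds`, registered stub
`stub_meanCeiling` (a CEILING IN THE MEAN, relative to packing, for the kernel block density
`ρ̄_φ(s, x) = empiricalDensityField ((Φ N).flow s z) (fun y => φ N (y - x)) = (N+1)⁻¹ ∑ᵢ φ_N(qᵢ(s) − x)`:
`∃ κ < 1 ∃ N₀ ∀ N ≥ N₀ ∀ s ∈ [0,t] ∀ x, E_{P_N} ρ̄_φ(s,x) · σ³ ≤ κ`).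

This file is the stub's EQUILIBRIUM UNIT TEST (rung 0 of the crux, `Disproof.lean` §9d): for CONSTANT profiles
`(a₀, u₀, θ₀) ≡ (a, u, θ)` (`0 < a`, `0 < θ`), EVERY family of hard-sphere flows `Φ_N`, every `N`, every time `s`
and every block centre `x`, the mean block density is EXACTLY the kernel mass,

  `∫ ρ̄_φ(s, x) dP_N = ∫ φ`   (`meanCeiling_integral_blockDensity_rung0`),

whence, for kernels of unit mass and `0 < σ ≤ 1/2`, the stub's conclusion on the rung with `κ := σ³ ≤ 1/8`
(`meanCeiling_equilibrium`, kernel block VERBATIM as in the stub).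

Proof of the identity: (1) STATIONARITY — the homogeneous local Gibbs law is invariant under every hard-sphere
flow (`integral_comp_flow_localGibbsLaw_const`, Liouville + energy/momentum conservation on the good set), so
`s` drops out; (2) the observable is positional, and the position marginal of the law is the configurational
canonical gas `posGibbsMeasure a ε_N (N+1)` (`LocalGibbsConcentration.integral_empiricalDensityField_localGibbsLaw`);
(3) TRANSLATION INVARIANCE of the canonical gas under the diagonal torus shift gives a UNIFORM one-particle
marginal: `∫ φ(qᵢ − x) dP = ∫ φ` for each `i` (`integral_mul_shiftInvariant` with the constant observable `1`,
`P` a probability measure for `σ ≤ 1/2`), and `(N+1)⁻¹ ∑ᵢ ∫φ = ∫φ`.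

No new definitions, no named facts; axioms `propext`, `Classical.choice`, `Quot.sound`.
-/

noncomputable section

open MeasureTheory ProbabilityTheory Filter Set Topology
open scoped ENNReal

namespace Summit.AtomisticToContinuum.HydrodynamicLimit.Theorems.MesoChebyshevWindow

open Literature.MathematicalPhysics.KineticTheory Literature.Analysis.FluidPDE
open Summit.AtomisticToContinuum.HydrodynamicLimit.Theorems.AprioriBoundsNegative (PartOneAt PartTwoAt)
open Summit.AtomisticToContinuum.HydrodynamicLimit.Theorems.VisitLedgerUpscattering (Cfg Flow Flows NiceProfiles)
open Summit.AtomisticToContinuum.HydrodynamicLimit.Theorems.FibreDeficitTransfer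

/-- The block density `z ↦ ρ̄_φ(z, x) = (N+1)⁻¹ ∑ᵢ φ(qᵢ − x)` of a continuous kernel is a measurable function of
the configuration. -/
theorem meanCeiling_measurable_blockDensity {N : ℕ} {φ : T3 → ℝ} (hφ : Continuous φ) (x : T3) :
    Measurable fun z : Config (N + 1) (Fin 3) T3 => empiricalDensityField z (fun y => φ (y - x)) := by
  have h : (fun z : Config (N + 1) (Fin 3) T3 => empiricalDensityField z (fun y => φ (y - x))) =
      fun z => ((N + 1 : ℕ) : ℝ)⁻¹ * ∑ i, φ ((z i).1 - x) :=
    funext fun z => AprioriBoundsNegative.empiricalDensityField_eq_sum z _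
  rw [h]
  refine measurable_const.mul (Finset.measurable_sum _ fun i _ => ?_)
  exact (hφ.comp (continuous_sub_right x)).measurable.comp (measurable_pi_apply i).fst

/-- **Uniform one-particle marginal of the homogeneous canonical gas**: for a constant activity `a > 0`,
`σ ≤ 1/2` (probability normalisation) and a continuous `φ`, `∫ φ(qᵢ − x) dP_N = ∫ φ` for every particle `i` and
every centre `x` (translation invariance of `posGibbsMeasure` under the diagonal shift, `integral_mul_shiftInvariant`
with the constant observable `1`, then `∫ φ(· − x) = ∫ φ` on `𝕋³`). -/
theorem meanCeiling_integral_kernel_posGibbs {σ a : ℝ} (hσ2 : σ ≤ 1 / 2) (ha : 0 < a) (N : ℕ)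
    (i : Fin (N + 1)) (x : T3) {φ : T3 → ℝ} (hφ : Continuous φ) :
    ∫ q, φ (q i - x) ∂posGibbsMeasure (fun _ : T3 => a) (hsDiameter σ N) (N + 1) = ∫ y, φ y := by
  haveI := isProbabilityMeasure_posGibbsMeasure (a₀ := fun _ : T3 => a) continuous_const (fun _ => ha) hσ2 N
  have h := integral_mul_shiftInvariant a (hsDiameter σ N) i (hφ.comp (continuous_sub_right x))
    (f := fun _ : Fin (N + 1) → T3 => (1 : ℝ)) measurable_const (B := 1)
    (fun _ => by rw [abs_one]) (fun _ _ => rfl)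
  simp only [Function.comp_apply, mul_one, integral_const, probReal_univ, smul_eq_mul] at h
  rw [h]
  exact integral_sub_right_eq_self φ x

/-- **The mean block density at homogeneous data is the kernel mass, along every flow.**  For constant profiles
`(a, u, θ)` with `0 < a`, `0 < θ`, `σ ≤ 1/2`, every hard-sphere flow `Φ` of `N + 1` spheres, every time `s`, every
centre `x` and every continuous kernel `φ`:
`∫ empiricalDensityField (Φ_s z) (φ(· − x)) dP_N = ∫ φ`.
Stationarity of the homogeneous law (`integral_comp_flow_localGibbsLaw_const`) + position marginal
(`LocalGibbsConcentration.integral_empiricalDensityField_localGibbsLaw`) + uniform one-particle marginal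
(`meanCeiling_integral_kernel_posGibbs`). -/
theorem meanCeiling_integral_blockDensity_rung0 {σ a θ : ℝ} (hσ2 : σ ≤ 1 / 2) (ha : 0 < a) (hθ : 0 < θ)
    (u : V3) (N : ℕ) (Φ : HardSphereFlow (Torus.geometry (Fin 3)) (hsDiameter σ N) (N + 1)) (s : ℝ) (x : T3)
    {φ : T3 → ℝ} (hφ : Continuous φ) :
    ∫ z, empiricalDensityField (Φ.flow s z) (fun y => φ (y - x))
        ∂(localGibbsLaw σ (fun _ => a) (fun _ => u) (fun _ => θ) N Φ) = ∫ y, φ y := by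
  -- (1) stationarity removes the flow
  rw [integral_comp_flow_localGibbsLaw_const σ a θ u N Φ s
    (f := fun z => empiricalDensityField z (fun y => φ (y - x)))
    (meanCeiling_measurable_blockDensity hφ x).aestronglyMeasurable]
  -- (2) the position marginal is the canonical gas
  rw [LocalGibbsConcentration.integral_empiricalDensityField_localGibbsLaw (a := fun _ => a)
    (θ₀ := fun _ => θ) (u₀ := fun _ => u) continuous_const continuous_const continuous_const
    (fun _ => ha.le) (fun _ => hθ) σ N Φ (f := fun y => φ (y - x)) (hφ.comp (continuous_sub_right x))]
  -- (3) uniform one-particle marginals, summed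
  haveI := isProbabilityMeasure_posGibbsMeasure (a₀ := fun _ : T3 => a) continuous_const (fun _ => ha) hσ2 N
  have hint : ∀ i : Fin (N + 1), Integrable (fun q : Fin (N + 1) → T3 => φ (q i - x))
      (posGibbsMeasure (fun _ : T3 => a) (hsDiameter σ N) (N + 1)) := fun i =>
    ((hφ.comp (continuous_sub_right x)).comp (continuous_apply i)).integrable_of_hasCompactSupport
      (HasCompactSupport.of_compactSpace _)
  rw [integral_finsetSum _ fun i _ => hint i]
  simp_rw [meanCeiling_integral_kernel_posGibbs hσ2 ha N _ x hφ]
  rw [Finset.sum_const, Finset.card_univ, Fintype.card_fin, nsmul_eq_mul, ← mul_assoc,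
    inv_mul_cancel₀ (by positivity), one_mul]

/-- **Equilibrium instance of stub `stub_meanCeiling` (the ceiling in the mean on the rung, `κ := σ³ ≤ 1/8`).**
For constant profiles `(a, u, θ)` (`0 < a`, `0 < θ`), `0 < σ ≤ 1/2`, EVERY family of hard-sphere flows, every
horizon `t` and every kernel family satisfying the crux's admissible-kernel block (verbatim; only continuity —
from smoothness — and unit mass are used): `E_{P_N} ρ̄_φ(s, x) · σ³ = σ³ ≤ 1/8 < 1` for all `N, s, x`
(`meanCeiling_integral_blockDensity_rung0`).  This is the stub's conclusion with `(a₀, u₀, θ₀) := (a, u, θ)`,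
`κ := σ³`, `N₀ := 0`. -/
theorem meanCeiling_equilibrium : ∀ (σ a θ : ℝ) (u : V3), 0 < σ → σ ≤ 1 / 2 → 0 < a → 0 < θ → ∀ (Φ : (N : ℕ) → HardSphereFlow (Torus.geometry (Fin 3)) (hsDiameter σ N) (N + 1)) (t γ C : ℝ) (φ : ℕ → T3 → ℝ), ((∀ N, Literature.Analysis.FunctionSpaces.Torus.IsSmooth (φ N)) ∧ (∀ N y, 0 ≤ φ N y) ∧ (∀ N, ∫ y, φ N y = 1) ∧ (∀ (N : ℕ) y, ((N : ℝ) + 1) ^ (-γ) ≤ Torus.euclidDist y 0 → φ N y = 0) ∧ (∀ (N : ℕ) y, φ N y ≤ C * ((N : ℝ) + 1) ^ (3 * γ)) ∧ (∀ (N : ℕ) y, ‖Literature.Analysis.FunctionSpaces.Torus.gradient (φ N) y‖ ≤ C * ((N : ℝ) + 1) ^ (4 * γ))) → ∃ κ : ℝ, κ < 1 ∧ ∃ N₀ : ℕ, ∀ N : ℕ, N₀ ≤ N → ∀ s ∈ Icc 0 t, ∀ x : T3, (∫ z, empiricalDensityField ((Φ N).flow s z) (fun y => φ N (y - x)) ∂(localGibbsLaw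 σ (fun _ => a) (fun _ => u) (fun _ => θ) N (Φ N))) * σ ^ 3 ≤ κ := by
  intro σ a θ u hσ hσ2 ha hθ Φ t γ C φ hφ
  obtain ⟨hsm, -, hmass, -, -, -⟩ := hφ
  have hσ3 : σ ^ 3 ≤ (1 / 2) ^ 3 := pow_le_pow_left₀ hσ.le hσ2 3
  refine ⟨σ ^ 3, lt_of_le_of_lt hσ3 (by norm_num), 0, fun N _ s _ x => ?_⟩
  rw [meanCeiling_integral_blockDensity_rung0 hσ2 ha hθ u N (Φ N) s x (hsm N).continuous, hmass N, one_mul]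

end Summit.AtomisticToContinuum.HydrodynamicLimit.Theorems.MesoChebyshevWindow

end
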